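import Summits.QuantumFields.YangMills.Theorems.OnsetSkewLawRPOnsetFloorCoarseCollarUV
import Summits.QuantumFields.YangMills.Theorems.OnsetSkewLawRPOnsetFloorCellShift
import Summits.QuantumFields.YangMills.Theorems.OnsetSkewLawRPOnsetFloorUVQuiet
import Summits.QuantumFields.YangMills.Theorems.OnsetSkewLawRPOnsetFloorOSPigeonhole
import Summits.QuantumFields.YangMills.Theorems.MarkovAtomsOnsetFloorMarkovTail
import Summits.QuantumFields.GaugeBoot.ClassBLimitSymmetry
import HarnessLib

/-!
# Cruxes `OnsetSkewLaw.RPOnsetFloor` (stmt-QuantumFields-23138) and `MarkovAtoms.OnsetFloor` (stmt-QuantumFields-22956): the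
# SHARED load-bearing stub `stub_coarseCollarAtomRPFloor` from an atomic cross floor — steps S3–S8 of the coarse-collar chain

LINES «FloorInheritance» v5 (sha 09e801d0, on 23138) and «MarkovFloorInheritance» v3 (sha a4a257d4, on 22956) of planner
ym-idea-11 g13 share VERBATIM the stub `stub_coarseCollarAtomRPFloor : StubCoarseCollarP` (collar synthesis + UV quietness +
the two-point floor residual `OnsetFloorQ2` ⇒ a COARSE positive-time collar atom with RP square `≥ ε`).  The planner's memo
`pub/ideators/ym-idea-11/g13/coarse-collar-memo.md` splits its proof into S1 (limit passage of the torus floor), S2 (atomic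
expansion of the two smeared fields in the RP cone), and the generic tail S3–S8.  THIS FILE PROVES THE GENERIC TAIL as one
implication

  `coarseCollar_of_crossFloor : CrossFloorAtomsP → StubCoarseCollarP`,

where `CrossFloorAtomsP` (§0, NEW statement = S1 + S2, to be supplied by the line: GO of planner ym-idea-11 g13, cell STATUS
2026-08-29T04:23:44Z, «two ℓ¹ atomic families in the cone, primed = atoms of B′, unprimed = atoms of A_v, floor
ε ≤ Cov((Σ' a′ F′)∘Θ, Σ' a F)») says: for every SU(2)-class `G` there are `r`, an admissible collar bump `(b,R₀,t)`, `ε₀, K > 0`, `β₅`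
such that every odd-torus limit state at `β ≥ β₅` carries two countable families of `b`-atoms
`F_I = Σ'_x b(s_I(x + o_{q_I}) − y_I)·P_{q_I}(x)` (valid orientations, spacings `s_I ≥ s > 0`, offset heights `≥ −s_I/2` — the
atoms of `B′` in centre coordinates sit at height `η₀/σ − s_I/2`, negative for fine atoms low in the slab — and, whenever COARSE
(`s_I ≤ 1`), offset height `≥ 0` and the collar inequality) with `ℓ¹` coefficients of mass `≤ K` and
`ε₀ ≤ Cov_μ((Σ' a′_J F′_J) ∘ Θ_cfg, Σ' a_I F_I)`.

Proof of the tail (all inputs are tree theorems; the atom lemmas `atom_comp_cfgReflect`, `abs_atom_le`, `abs_covariance_le`,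
`rp_real`, `atom_dependsOn_of_valid`, `abs_rpSq_le_of_deficit` are parts 1/1b, `OnsetSkewLawRPOnsetFloorCoarseCollarAtoms.lean` /
`OnsetSkewLawRPOnsetFloorCoarseCollarUV.lean`): S3 `OSPigeonhole.covariance_tsum_tsum` (the cross floor is the `ℓ¹` pair
series of atom covariances; atoms are continuous — `MarkovAtomsOnsetFloorMarkovTail.continuous_bumpAtom` — and uniformly bounded,
`abs_atom_le`, since `s_I ≥ s`); S4 `OSPigeonhole.abs_cov_le_osNorm_mul` (RP Cauchy–Schwarz on the cone `DependsOn · (siteHalfEdges 0)`;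
site-RP `GaugeBoot.siteRP_zero_of_mem_infiniteVolumeLimitPoints` at `β ≥ 0` in real form `rp_real`, `Θ`-invariance
`GaugeBoot.map_configSiteReflect_zero_eq_of_mem_infiniteVolumeLimitPoints`, atoms in the cone `atom_dependsOn_of_valid`); S5
`OSPigeonhole.os_pigeonhole` (an active atom with OS square `≥ ε₀/K²` in one of the two families); S6 the OS square IS the route's
`rpSq {q} s y` (`MarkovAtomsOnsetFloorMarkovTail.rpSq_eq_integral_centred` + the mirror law `atom_comp_cfgReflect`); S7 UV atoms are
impossible AT ANY OFFSET: the weak-coupling plaquette deficit of odd-torus limit states (`OnsetSkewLawGlue.integral_deficit_le`)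
makes every centred two-point weight small, hence `|rpSq| ≤ ((⌈R₀⌉₊+1)⁴ M_b)²·2N²η < ε₀/K²` for spacing `≥ 1`
(`abs_rpSq_le_of_deficit`; no cell-offset hypothesis, so the stub's input `StubUVQuietP` is not even used); S8 levels
`ε₁ := ε₀/K²`, `β₅(ε) := max β₅ (max β₀ 0)`.

With S1 + S2 (i.e. a proof of `CrossFloorAtomsP` from the collar synthesis and `OnsetFloorQ2`) the registered stub follows in one
line: `stub_coarseCollarAtomRPFloor := coarseCollar_of_crossFloor crossFloorAtoms` (checked: with `hCF : CrossFloorAtomsP`,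
`example : StubCoarseCollarP := coarseCollar_of_crossFloor hCF` elaborates inside BOTH registered skeletons, rc 0).
§0 records the registered texts VERBATIM (`PosTimeSynthC`, `OnsetFloorQ2`, `StubCoarseCollarP`; `AdmBump` / `StubUVQuietP` are the
tree copies of `RPOnsetFloorCellShift` / `RPOnsetFloorUVQuiet`) — registered-stub copies, not citable facts.

HONEST FRAMING: a conditional assembly for ONE shared stub of two OPEN lines; `CrossFloorAtomsP` (S1+S2), `stub_singleSlot`,
`stub_positiveTimeSynthesisCollar` and the residual `OnsetFloorQ2` remain open; no crux, rung or summit is proved; the Yang–Mills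
mass gap is NOT proved.  Cell `ym-idea-1`, width seat `ym-line-sfw-p2-w5` g16 (free hands), on planner ym-idea-11 g13's GO.
References: K. Osterwalder, E. Seiler, Ann. Phys. 110 (1978) 440, §2 [OsterwalderSeiler1978]; J. Glimm, A. Jaffe, Quantum Physics
(1987) §6.1. [folklore]
-/

set_option autoImplicit false

noncomputable section

open scoped BigOperators
open MeasureTheory ProbabilityTheory Filter Topology
open Literature.MathematicalPhysics.QuantumFieldTheory Literature.MathematicalPhysics.QuantumLattice
open Literature.Probability.LatticeModels (Site)
open Summit.QuantumFields.YangMills.Cruxes.OSLegsFromFemtoAndGap.DlrCollarTransfer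
  (plane continuous_plane)
open Summit.QuantumFields.GaugeBoot (configSiteReflect siteHalfEdges IsReflectionPositiveFor
  siteRP_zero_of_mem_infiniteVolumeLimitPoints configSiteReflect_configSiteReflect
  map_configSiteReflect_zero_eq_of_mem_infiniteVolumeLimitPoints)
open Summit.QuantumFields.YangMills.Theorems.InfiniteVolume (stateMomentStr)
open Summit.QuantumFields.YangMills.Theorems.InfVolRP (reflSite reflSite_reflSite plane_cfgReflect
  smul_reflSite_add_of_centre mem_infiniteVolumeLimitPoints_of_mem_oddTorusLimitPoints centreOffset
  two_mul_centreOffset_zero centreOffset_time configSiteReflect_zero_eq_cfgReflect dependsOn_plane)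
open Summit.QuantumFields.YangMills.Theorems.RPOnsetFloorCellShift (AdmBump)
open Summit.QuantumFields.YangMills.Theorems.RPOnsetFloorUVQuiet (PartII StubUVQuietP)
open Summit.QuantumFields.YangMills.Theorems.OnsetSkewLawRPOnsetFloorOSPigeonhole (os_pigeonhole abs_cov_le_osNorm_mul
  covariance_tsum_tsum)
open Summit.QuantumFields.YangMills.Theorems.FiniteSusceptibilityWeakCoupling.RPCauchySchwarz (covariance_comp_eq
  integral_comp_eq)
open Summit.QuantumFields.YangMills.Theorems.MarkovAtomsOnsetFloorMarkovTail (rpSq_eq_integral_centred mirrorOffset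
  mirror_weight atomSites bumpAtom_eq_sum continuous_bumpAtom abs_bumpAtom_le)

namespace Summit.QuantumFields.YangMills.Theorems.RPOnsetFloorCoarseCollar

/-! ## §0 Registered texts (verbatim from the skeletons; registered-stub copies, not citable facts) -/

/-- QUANTITATIVE positive-time atomic synthesis WITH COLLAR CLAUSE (verbatim the skeletons' `PosTimeSynthC`). -/
abbrev PosTimeSynthC (b : SchwartzMap (EuclideanSpace ℝ (Fin 4)) ℝ) (C : ℝ) (N : ℕ) : Prop :=
  ∀ (v : SchwartzMap (EuclideanSpace ℝ (Fin 4)) ℝ) (Mv : ℝ), tsupport v ⊆ {y : EuclideanSpace ℝ (Fin 4) | 0 < y 0} →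
    (∀ m : ℕ, m ≤ N → ∀ z : EuclideanSpace ℝ (Fin 4), 0 < z 0 →
        (1 + ‖z‖) ^ 14 * ‖iteratedFDeriv ℝ m v z‖ ≤ Mv * (min (z 0) 1) ^ (5 - m)) →
    ∃ (coef : ℕ → ℝ) (σ : ℕ → ℝ) (η : ℕ → EuclideanSpace ℝ (Fin 4)),
      Summable (fun i => |coef i|) ∧ ∑' i, |coef i| ≤ C * Mv ∧ (∀ i, 0 < σ i ∧ σ i ≤ 1) ∧
      (∀ i, 8 * σ i ≤ η i 0) ∧
      (∀ i (z : EuclideanSpace ℝ (Fin 4)), z 0 ≤ 0 → b ((σ i)⁻¹ • (z - η i)) = 0) ∧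
      ∀ z, v z = ∑' i, coef i * b ((σ i)⁻¹ • (z - η i))

/-- The TWO-POINT conjunct of the shared floor residual (verbatim the skeletons' `OnsetFloorQ2`). -/
abbrev OnsetFloorQ2 : Prop :=
  open Summit.QuantumFields.YangMills.Cruxes.OSLegsFromFemtoAndGap.DlrCollarTransfer in
  ∀ (G : Type) [Group G] [TopologicalSpace G] [IsTopologicalGroup G] [CompactSpace G],
    IsCompactSimpleLieGroup G → Nonempty (G ≃ₜ* Matrix.specialUnitaryGroup (Fin 2) ℂ) →
    letI : MeasurableSpace G := borel G
    haveI : BorelSpace G := ⟨rfl⟩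
    ∃ (r : LatticeRep G) (v : SchwartzMap (EuclideanSpace ℝ (Fin 4)) ℝ) (ε Λ₅ β₅ : ℝ),
      tsupport v ⊆ {y : EuclideanSpace ℝ (Fin 4) | 0 < y 0} ∧ 0 < ε ∧
      ∀ β : ℝ, β₅ ≤ β → ∃ s : ℝ, 0 < s ∧ s ≤ 1 ∧ ∀ L : ℕ, Λ₅ ≤ s * L → ε ≤ Q2 G r β L s (thetaTest 4 v) v

/-- The shared coarse-collar-atom stub (verbatim the skeletons' `StubCoarseCollarP`; `AdmBump` is the tree copy of
`RPOnsetFloorCellShift`, `StubUVQuietP` that of `RPOnsetFloorUVQuiet`). -/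
abbrev StubCoarseCollarP : Prop :=
  (∀ (b : SchwartzMap (EuclideanSpace ℝ (Fin 4)) ℝ) (R₀ t : ℝ), AdmBump b R₀ t → ∃ (C : ℝ) (N : ℕ), 0 ≤ C ∧ PosTimeSynthC b C N) →
    StubUVQuietP → OnsetFloorQ2 →
    ∀ (G : Type) [Group G] [TopologicalSpace G] [IsTopologicalGroup G] [CompactSpace G],
      IsCompactSimpleLieGroup G → Nonempty (G ≃ₜ* Matrix.specialUnitaryGroup (Fin 2) ℂ) →
      letI : MeasurableSpace G := borel G
      haveI : BorelSpace G := ⟨rfl⟩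
      ∃ (r : LatticeRep G) (b : SchwartzMap (EuclideanSpace ℝ (Fin 4)) ℝ) (R₀ t ε₁ : ℝ), AdmBump b R₀ t ∧ 0 < ε₁ ∧
        ∀ ε : ℝ, 0 < ε → ε ≤ ε₁ → ∃ β₅ : ℝ, ∀ β : ℝ, β₅ ≤ β → ∀ μ ∈ oddTorusLimitPoints r β,
          let wt : Finset (Fin 4 × Fin 4) → ℝ → EuclideanSpace ℝ (Fin 4) → (Fin 4 × Fin 4) × (Fin 4 → ℤ) → ℝ := fun Q s y p => if p.1 ∈ Q ∧ p.1.1 < p.1.2 then b (s • (siteToE p.2 + centreOffset p.1) - y) else 0 ; let wr : Finset (Fin 4 × Fin 4) → ℝ → EuclideanSpace ℝ (Fin 4) → (Fin 4 × Fin 4) × (Fin 4 → ℤ) → ℝ := fun Q s y p => if p.1 ∈ Q ∧ p.1.1 < p.1.2 then b (timeReflection 4 (s • (siteToE p.2 + centreOffset p.1)) - y) else 0 ; let rpSq : Finset (Fin 4 × Fin 4) → ℝ → EuclideanSpace ℝ (Fin 4) → ℝ := fun Q s y => ∑' pp : ((Fin 4 × Fin 4) × (Fin 4 → ℤ)) ×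 ((Fin 4 × Fin 4) × (Fin 4 → ℤ)), wr Q s y pp.1 * wt Q s y pp.2 * stateMomentStr G r μ 2 ![pp.1.1, pp.2.1] ![pp.1.2, pp.2.2] ; ∃ s : ℝ, 0 < s ∧ s ≤ 1 ∧ ∃ (q : Fin 4 × Fin 4) (y : EuclideanSpace ℝ (Fin 4)),
            q.1 < q.2 ∧ 0 ≤ y 0 ∧ R₀ + 1 + 9 * s ≤ 2 * y 0 + t ∧ ε ≤ rpSq {q} s y

/-- **`CrossFloorDatum G`** — the per-`G` content of `CrossFloorAtomsP` (steps S1 + S2 of the coarse-collar chain for one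
gauge group with its Borel structure): a datum `r`, an admissible collar bump `(b, R₀, t)`, a floor `ε₀ > 0`, an `ℓ¹` mass bound
`K > 0` and a threshold `β₅` such that every odd-torus limit state at `β ≥ β₅` carries TWO countable families of `b`-atoms
`F_I = Σ'_x b(s_I (x + o_{q_I}) − y_I)·P_{q_I}(x)` (primed: the atoms of the reflected companion `B′_{v,s}`; unprimed: the atoms
of `A_{v,s}`), all of spacing `s_I ≥ s > 0` (uniform site count), valid orientation, offset height `≥ −s_I/2` (so every weighted
plaquette has base height `≥ 0`; the atoms of `B′` in centre coordinates sit at height `η₀/σ − s_I/2`, negative for fine atoms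
low in the slab) and, whenever COARSE (`s_I ≤ 1`), offset height `≥ 0` and the collar inequality; `ℓ¹` coefficients of mass
`≤ K`; cross floor `ε₀ ≤ Cov_μ((Σ' a′_J F′_J) ∘ Θ_cfg, Σ' a_I F_I)`. -/
abbrev CrossFloorDatum (G : Type) [Group G] [TopologicalSpace G] [IsTopologicalGroup G] [CompactSpace G]
    [MeasurableSpace G] [BorelSpace G] : Prop :=
  ∃ (r : LatticeRep G) (b : SchwartzMap (EuclideanSpace ℝ (Fin 4)) ℝ) (R₀ t ε₀ K : ℝ), AdmBump b R₀ t ∧ 0 < ε₀ ∧ 0 < K ∧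
    ∃ β₅ : ℝ, ∀ β : ℝ, β₅ ≤ β → ∀ μ ∈ oddTorusLimitPoints r β,
      ∃ s : ℝ, 0 < s ∧
      ∃ (ι : Type) (_ : Countable ι) (a : ι → ℝ) (q : ι → Fin 4 × Fin 4) (sI : ι → ℝ) (y : ι → EuclideanSpace ℝ (Fin 4))
        (ι' : Type) (_ : Countable ι') (a' : ι' → ℝ) (q' : ι' → Fin 4 × Fin 4) (sI' : ι' → ℝ)
        (y' : ι' → EuclideanSpace ℝ (Fin 4)),
        Summable (fun i => |a i|) ∧ ∑' i, |a i| ≤ K ∧ Summable (fun j => |a' j|) ∧ ∑' j, |a' j| ≤ K ∧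
        (∀ i, (q i).1 < (q i).2 ∧ s ≤ sI i ∧ -(sI i / 2) ≤ y i 0 ∧
          (sI i ≤ 1 → 0 ≤ y i 0 ∧ R₀ + 1 + 9 * sI i ≤ 2 * y i 0 + t)) ∧
        (∀ j, (q' j).1 < (q' j).2 ∧ s ≤ sI' j ∧ -(sI' j / 2) ≤ y' j 0 ∧
          (sI' j ≤ 1 → 0 ≤ y' j 0 ∧ R₀ + 1 + 9 * sI' j ≤ 2 * y' j 0 + t)) ∧
        ε₀ ≤ cov[fun U => ∑' j, a' j *
                  (∑' x : Fin 4 → ℤ, b (sI' j • (siteToE x + centreOffset (q' j)) - y' j) * plane G r (q' j) x (cfgReflect U)),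
                fun U => ∑' i, a i *
                  (∑' x : Fin 4 → ℤ, b (sI i • (siteToE x + centreOffset (q i)) - y i) * plane G r (q i) x U); μ]

/-- **`CrossFloorAtomsP`** (steps S1 + S2 of the planner's coarse-collar chain, the line-specific input of this file): collar
synthesis for admissible bumps and the two-point floor datum `OnsetFloorQ2` give `CrossFloorDatum G` for every `SU(2)`-class `G`
(with its Borel structure). -/
abbrev CrossFloorAtomsP : Prop :=
  (∀ (b : SchwartzMap (EuclideanSpace ℝ (Fin 4)) ℝ) (R₀ t : ℝ), AdmBump b R₀ t → ∃ (C : ℝ) (N : ℕ), 0 ≤ C ∧ PosTimeSynthC b C N) →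
    OnsetFloorQ2 →
    ∀ (G : Type) [Group G] [TopologicalSpace G] [IsTopologicalGroup G] [CompactSpace G],
      IsCompactSimpleLieGroup G → Nonempty (G ≃ₜ* Matrix.specialUnitaryGroup (Fin 2) ℂ) →
      letI : MeasurableSpace G := borel G
      haveI : BorelSpace G := ⟨rfl⟩
      CrossFloorDatum G

/-! ## §2 The assembly (steps S3–S8 of the coarse-collar chain) -/

/-- **A coarse collar atom from a cross-floor datum** (S3–S8, for every compact `G` with its Borel structure):
`CrossFloorDatum G` ⇒ the per-`G` conclusion of `StubCoarseCollarP`.  Proof: the cross floor `ε₀ ≤ Cov((Σ' a′_J F′_J)∘Θ, Σ' a_I F_I)` is the `ℓ¹` pair series of atom covariances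
(`covariance_tsum_tsum`); each is dominated by the product of OS seminorms `n = √Cov(F∘Θ, F)` (RP Cauchy–Schwarz
`abs_cov_le_osNorm_mul`; site-RP and `Θ`-invariance of torus limit states at `β ≥ 0`; atoms in the cone by `atom_dependsOn_of_valid`);
the pigeonhole `os_pigeonhole` selects an active atom with `n² ≥ ε₀/K²` in one of the two families; `n² = rpSq {q} s y` (the
route's text; `rpSq_eq_integral_centred` + the mirror law `atom_comp_cfgReflect`); a UV atom (`s > 1`) is impossible at
`β ≥ β₀` by the weak-coupling plaquette deficit (`OnsetSkewLawGlue.integral_deficit_le` + `abs_rpSq_le_of_deficit`, ANY offset);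
so the atom is coarse, has offset height `≥ 0` and carries the collar inequality.  Levels: `ε₁ := ε₀/K²`,
`β₅(ε) := max β₅ (max β₀ 0)`.  (The stub's hypothesis `StubUVQuietP` is not even used.) [cite: OsterwalderSeiler1978, §2] -/
theorem coarseAtomFloor_of_crossFloorDatum {G : Type} [Group G] [TopologicalSpace G] [IsTopologicalGroup G]
    [CompactSpace G] [MeasurableSpace G] [BorelSpace G] (hQ : CrossFloorDatum G) :
    ∃ (r : LatticeRep G) (b : SchwartzMap (EuclideanSpace ℝ (Fin 4)) ℝ) (R₀ t ε₁ : ℝ), AdmBump b R₀ t ∧ 0 < ε₁ ∧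
    ∀ ε : ℝ, 0 < ε → ε ≤ ε₁ → ∃ β₅ : ℝ, ∀ β : ℝ, β₅ ≤ β → ∀ μ ∈ oddTorusLimitPoints r β,
      let wt : Finset (Fin 4 × Fin 4) → ℝ → EuclideanSpace ℝ (Fin 4) → (Fin 4 × Fin 4) × (Fin 4 → ℤ) → ℝ := fun Q s y p => if p.1 ∈ Q ∧ p.1.1 < p.1.2 then b (s • (siteToE p.2 + centreOffset p.1) - y) else 0 ; let wr : Finset (Fin 4 × Fin 4) → ℝ → EuclideanSpace ℝ (Fin 4) → (Fin 4 × Fin 4) × (Fin 4 → ℤ) → ℝ := fun Q s y p => if p.1 ∈ Q ∧ p.1.1 < p.1.2 then b (timeReflection 4 (s • (siteToE p.2 + centreOffset p.1)) - y) else 0 ; let rpSq : Finset (Fin 4 × Fin 4) → ℝ → EuclideanSpace ℝ (Fin 4) → ℝ := fun Q s y => ∑' pp : ((Fin 4 × Fin 4) × (Fin 4 → ℤ)) × ((Fin 4 × Fin 4) × (Fin 4 → ℤ)), wr Q s y pp.1 * wt Q s y pp.2 * stateMomentStr G r μ 2 ![pp.1.1, pp.2.1] ![pp.1.2, pp.2.2]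 ; ∃ s : ℝ, 0 < s ∧ s ≤ 1 ∧ ∃ (q : Fin 4 × Fin 4) (y : EuclideanSpace ℝ (Fin 4)),
        q.1 < q.2 ∧ 0 ≤ y 0 ∧ R₀ + 1 + 9 * s ≤ 2 * y 0 + t ∧ ε ≤ rpSq {q} s y := by
  obtain ⟨r, b, R₀, t, ε₀, K, hb, hε₀, hK, β₅, hmain⟩ := hQ
  haveI : SecondCountableTopology G :=
    (r.continuous.isClosedEmbedding r.injective).isEmbedding.secondCountableTopology
  haveI : T2Space G := (r.continuous.isClosedEmbedding r.injective).isEmbedding.t2Space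
  -- the bump: `0 ≤ R₀`, a bound `Mb`
  have hR₀ : 0 ≤ R₀ := by
    by_contra hneg
    push Not at hneg
    apply hb.2.2.2.1
    have hzero : ∀ u, b u = 0 := fun u => by
      by_contra hne
      have hmem := hb.2.1 (subset_tsupport _ hne)
      have h0 := hmem 0
      linarith [h0.1, h0.2]
    simp [hzero]
  obtain ⟨Mb, hMb⟩ : ∃ Mb : ℝ, ∀ u, |b u| ≤ Mb := by
    obtain ⟨C, hC⟩ := (SchwartzMap.continuous b).bounded_above_of_compact_support hb.1
    exact ⟨C, fun u => by have h := hC u; rwa [Real.norm_eq_abs] at h⟩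
  have hMb0 : 0 ≤ Mb := (abs_nonneg _).trans (hMb 0)
  -- levels: `ε₁ = ε₀/K²`; the UV budget `η` and its coupling threshold `β₀`
  set ε₁ : ℝ := ε₀ / (K * K) with hε₁
  have hε₁pos : 0 < ε₁ := div_pos hε₀ (mul_pos hK hK)
  set C1 : ℝ := ((⌈R₀ / 1⌉₊ + 1 : ℕ) : ℝ) ^ 4 * Mb with hC1
  have hC10 : 0 ≤ C1 := mul_nonneg (by positivity) hMb0
  set η : ℝ := ε₁ / (2 * ((r.N : ℝ) ^ 2 + 1) * (C1 ^ 2 + 1)) with hη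
  have hη0 : 0 < η := by positivity
  obtain ⟨β₀, hβ₀⟩ := Summit.QuantumFields.YangMills.Theorems.OnsetSkewLawGlue.integral_deficit_le r hη0
  have hUV : C1 ^ 2 * (2 * r.N * (r.N * η)) < ε₁ := by
    have hN : (0 : ℝ) ≤ r.N := Nat.cast_nonneg _
    have hrew : C1 ^ 2 * (2 * r.N * (r.N * η)) =
        ε₁ * (C1 ^ 2 / (C1 ^ 2 + 1)) * ((r.N : ℝ) ^ 2 / ((r.N : ℝ) ^ 2 + 1)) := by
      rw [hη]
      field_simp
    rw [hrew]
    have h1 : C1 ^ 2 / (C1 ^ 2 + 1) < 1 := by rw [div_lt_one (by positivity)]; linarith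
    have h2 : (r.N : ℝ) ^ 2 / ((r.N : ℝ) ^ 2 + 1) ≤ 1 := by rw [div_le_one (by positivity)]; linarith
    have h3 : 0 ≤ C1 ^ 2 / (C1 ^ 2 + 1) := by positivity
    calc ε₁ * (C1 ^ 2 / (C1 ^ 2 + 1)) * ((r.N : ℝ) ^ 2 / ((r.N : ℝ) ^ 2 + 1))
        ≤ ε₁ * (C1 ^ 2 / (C1 ^ 2 + 1)) * 1 :=
          mul_le_mul_of_nonneg_left h2 (mul_nonneg hε₁pos.le h3)
      _ = ε₁ * (C1 ^ 2 / (C1 ^ 2 + 1)) := mul_one _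
      _ < ε₁ * 1 := mul_lt_mul_of_pos_left h1 hε₁pos
      _ = ε₁ := mul_one _
  refine ⟨r, b, R₀, t, ε₁, hb, hε₁pos, fun ε hε hεle => ⟨max β₅ (max β₀ 0), fun β hβ μ hμ => ?_⟩⟩
  intro wt wr rpSq
  have hβ₅ : β₅ ≤ β := (le_max_left _ _).trans hβ
  have hβ₀' : β₀ ≤ β := ((le_max_left _ _).trans (le_max_right _ _)).trans hβ
  have hβ0 : 0 ≤ β := ((le_max_right _ _).trans (le_max_right _ _)).trans hβ
  obtain ⟨s, hs, ι, hι, a, q, sI, y, ι', hι', a', q', sI', y', ha, haK, ha', haK', hfam, hfam', hfloor⟩ :=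
    hmain β hβ₅ μ hμ
  haveI := hι
  haveI := hι'
  -- the state: probability, `Θ`-invariant, site-RP; the plaquette deficit at `β ≥ β₀`
  have hμinf := mem_infiniteVolumeLimitPoints_of_mem_oddTorusLimitPoints r hμ
  obtain ⟨-, -, hprob, -⟩ := id hμinf
  have hΘm : Measurable (cfgReflect (G := G)) := measurable_cfgReflect
  have hΘμ : μ.map (cfgReflect (G := G)) = μ := by
    have h := map_configSiteReflect_zero_eq_of_mem_infiniteVolumeLimitPoints r.ρ r.continuous hμinf
    have hfun : (configSiteReflect (G := G) (0 : Fin 4)) = cfgReflect :=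
      funext fun U => configSiteReflect_zero_eq_cfgReflect U
    rwa [hfun] at h
  have hΘΘ : ∀ U : LGConfig 4 G, cfgReflect (cfgReflect U) = U := fun U => by
    rw [← configSiteReflect_zero_eq_cfgReflect, ← configSiteReflect_zero_eq_cfgReflect,
      configSiteReflect_configSiteReflect]
  have hRP : IsReflectionPositiveFor (configSiteReflect (G := G) 0) (siteHalfEdges 0) μ :=
    siteRP_zero_of_mem_infiniteVolumeLimitPoints r.ρ r.continuous hβ0 hμinf
  have hRPr : ∀ H : LGConfig 4 G → ℝ, Measurable H → (∃ C, ∀ U, |H U| ≤ C) →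
      DependsOn H (siteHalfEdges (d := 4) 0) → 0 ≤ ∫ U, H (cfgReflect U) * H U ∂μ :=
    fun H hH hC hD => rp_real hRP H hH hC hD
  have hDadd : ∀ (H H' : LGConfig 4 G → ℝ) (c : ℝ), DependsOn H (siteHalfEdges (d := 4) 0) →
      DependsOn H' (siteHalfEdges (d := 4) 0) → DependsOn (fun U => H U + c * H' U) (siteHalfEdges (d := 4) 0) :=
    fun H H' c hH hH' U V hUV => by simp only [hH hUV, hH' hUV]
  have hDsub : ∀ (H : LGConfig 4 G → ℝ) (c : ℝ), DependsOn H (siteHalfEdges (d := 4) 0) →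
      DependsOn (fun U => H U - c) (siteHalfEdges (d := 4) 0) :=
    fun H c hH U V hUV => by simp only [hH hUV]
  have hdef := hβ₀ β hβ₀' μ hμ
  -- the atoms of the two families
  set F : ι → LGConfig 4 G → ℝ := fun i U =>
    ∑' x : Fin 4 → ℤ, b (sI i • (siteToE x + centreOffset (q i)) - y i) * plane G r (q i) x U with hFdef
  set F' : ι' → LGConfig 4 G → ℝ := fun j U =>
    ∑' x : Fin 4 → ℤ, b (sI' j • (siteToE x + centreOffset (q' j)) - y' j) * plane G r (q' j) x U with hF'def
  set B : ℝ := ((⌈R₀ / s⌉₊ + 1 : ℕ) : ℝ) ^ 4 * Mb * r.N with hB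
  have hB0 : 0 ≤ B := mul_nonneg (mul_nonneg (by positivity) hMb0) (Nat.cast_nonneg _)
  have hFb : ∀ i U, |F i U| ≤ B := fun i U => abs_atom_le r hR₀ hb.2.1 hMb hs (hfam i).2.1 (q i) (y i) U
  have hF'b : ∀ j U, |F' j U| ≤ B := fun j U => abs_atom_le r hR₀ hb.2.1 hMb hs (hfam' j).2.1 (q' j) (y' j) U
  have hFm : ∀ i, Measurable (F i) := fun i =>
    (continuous_bumpAtom G r b hb.2.1 (hs.trans_le (hfam i).2.1) (q i) (y i)).measurable
  have hF'm : ∀ j, Measurable (F' j) := fun j =>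
    (continuous_bumpAtom G r b hb.2.1 (hs.trans_le (hfam' j).2.1) (q' j) (y' j)).measurable
  have hFd : ∀ i, DependsOn (F i) (siteHalfEdges (d := 4) 0) := fun i =>
    atom_dependsOn_of_valid r hb.2.2.1 (hs.trans_le (hfam i).2.1) (hfam i).1 (hfam i).2.2.1
  have hF'd : ∀ j, DependsOn (F' j) (siteHalfEdges (d := 4) 0) := fun j =>
    atom_dependsOn_of_valid r hb.2.2.1 (hs.trans_le (hfam' j).2.1) (hfam' j).1 (hfam' j).2.2.1
  -- S3: the cross floor as the `ℓ¹` pair series of atom covariances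
  have hS3 := covariance_tsum_tsum (μ := μ) (G := fun j U => F' j (cfgReflect U)) ha ha' hFm
    (fun j => (hF'm j).comp hΘm) hFb (fun j U => hF'b j (cfgReflect U))
  have hfloor' : ε₀ ≤ ∑' p : ι' × ι, a' p.1 * a p.2 * cov[fun U => F' p.1 (cfgReflect U), F p.2; μ] := by
    rw [← hS3]; exact hfloor
  -- S4: RP–Cauchy–Schwarz domination by the OS seminorms
  have hCS : ∀ (j : ι') (i : ι), |cov[fun U => F' j (cfgReflect U), F i; μ]| ≤
      √(cov[fun U => F' j (cfgReflect U), F' j; μ]) * √(cov[fun U => F i (cfgReflect U), F i; μ]) := fun j i =>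
    (abs_cov_le_osNorm_mul (μ := μ) hΘm hΘμ hΘΘ (D := fun H => DependsOn H (siteHalfEdges (d := 4) 0)) hRPr hDadd
      hDsub (hF'm j) (hFm i) ⟨B, hF'b j⟩ ⟨B, hFb i⟩ (hF'd j) (hFd i)).2.2
  have hnn : ∀ i, 0 ≤ cov[fun U => F i (cfgReflect U), F i; μ] := fun i =>
    (abs_cov_le_osNorm_mul (μ := μ) hΘm hΘμ hΘΘ (D := fun H => DependsOn H (siteHalfEdges (d := 4) 0)) hRPr hDadd
      hDsub (hFm i) (hFm i) ⟨B, hFb i⟩ ⟨B, hFb i⟩ (hFd i) (hFd i)).1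
  have hnn' : ∀ j, 0 ≤ cov[fun U => F' j (cfgReflect U), F' j; μ] := fun j =>
    (abs_cov_le_osNorm_mul (μ := μ) hΘm hΘμ hΘΘ (D := fun H => DependsOn H (siteHalfEdges (d := 4) 0)) hRPr hDadd
      hDsub (hF'm j) (hF'm j) ⟨B, hF'b j⟩ ⟨B, hF'b j⟩ (hF'd j) (hF'd j)).1
  have hsqrt_le : ∀ {c : ℝ}, c ≤ 4 * B ^ 2 → √c ≤ 2 * B := fun {c} hc => by
    calc √c ≤ √(4 * B ^ 2) := Real.sqrt_le_sqrt hc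
      _ = 2 * B := by rw [show (4 : ℝ) * B ^ 2 = (2 * B) ^ 2 by ring, Real.sqrt_sq (by linarith)]
  have hnB : ∀ i, √(cov[fun U => F i (cfgReflect U), F i; μ]) ≤ 2 * B := fun i =>
    hsqrt_le ((le_abs_self _).trans (abs_covariance_le (μ := μ) (fun U => hFb i (cfgReflect U)) (hFb i)))
  have hnB' : ∀ j, √(cov[fun U => F' j (cfgReflect U), F' j; μ]) ≤ 2 * B := fun j =>
    hsqrt_le ((le_abs_self _).trans (abs_covariance_le (μ := μ) (fun U => hF'b j (cfgReflect U)) (hF'b j)))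
  -- S5: pigeonhole in the larger family
  have hpig := os_pigeonhole (a := a) (a' := a') (n := fun i => √(cov[fun U => F i (cfgReflect U), F i; μ]))
    (n' := fun j => √(cov[fun U => F' j (cfgReflect U), F' j; μ]))
    (M := fun j i => cov[fun U => F' j (cfgReflect U), F i; μ]) hε₀ hK hK ha ha' haK haK'
    (fun i => Real.sqrt_nonneg _) (fun j => Real.sqrt_nonneg _) hnB hnB' hCS hfloor'
  -- S6–S8 for one atom: OS square = the route's `rpSq`; UV atoms are excluded; coarse atoms carry the collar
  have key : ∀ (q₀ : Fin 4 × Fin 4) (s₀ : ℝ) (y₀ : EuclideanSpace ℝ (Fin 4)), q₀.1 < q₀.2 → s ≤ s₀ →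
      (s₀ ≤ 1 → 0 ≤ y₀ 0 ∧ R₀ + 1 + 9 * s₀ ≤ 2 * y₀ 0 + t) →
      ε₁ ≤ cov[fun U => (∑' x : Fin 4 → ℤ, b (s₀ • (siteToE x + centreOffset q₀) - y₀) * plane G r q₀ x (cfgReflect U)),
               fun U => ∑' x : Fin 4 → ℤ, b (s₀ • (siteToE x + centreOffset q₀) - y₀) * plane G r q₀ x U; μ] →
      ∃ s : ℝ, 0 < s ∧ s ≤ 1 ∧ ∃ (q : Fin 4 × Fin 4) (y : EuclideanSpace ℝ (Fin 4)),
        q.1 < q.2 ∧ 0 ≤ y 0 ∧ R₀ + 1 + 9 * s ≤ 2 * y 0 + t ∧ ε ≤ rpSq {q} s y := by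
    intro q₀ s₀ y₀ hq₀ hs₀ hcol hε₁le
    have hs₀pos : 0 < s₀ := hs.trans_le hs₀
    have hmeas : Measurable fun U : LGConfig 4 G =>
        ∑' x : Fin 4 → ℤ, b (s₀ • (siteToE x + centreOffset q₀) - y₀) * plane G r q₀ x U :=
      (continuous_bumpAtom G r b hb.2.1 hs₀pos q₀ y₀).measurable
    -- S6: the OS square of the atom is the route's RP square
    have hS6 : cov[fun U => (∑' x : Fin 4 → ℤ, b (s₀ • (siteToE x + centreOffset q₀) - y₀) * plane G r q₀ x (cfgReflect U)),
               fun U => ∑' x : Fin 4 → ℤ, b (s₀ • (siteToE x + centreOffset q₀) - y₀) * plane G r q₀ x U; μ] =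
        ∑' pp : ((Fin 4 × Fin 4) × (Fin 4 → ℤ)) × ((Fin 4 × Fin 4) × (Fin 4 → ℤ)),
          (if pp.1.1 ∈ ({q₀} : Finset (Fin 4 × Fin 4)) ∧ pp.1.1.1 < pp.1.1.2 then
              b (timeReflection 4 (s₀ • (siteToE pp.1.2 + centreOffset pp.1.1)) - y₀) else 0) *
            (if pp.2.1 ∈ ({q₀} : Finset (Fin 4 × Fin 4)) ∧ pp.2.1.1 < pp.2.1.2 then
              b (s₀ • (siteToE pp.2.2 + centreOffset pp.2.1) - y₀) else 0) *
            stateMomentStr G r μ 2 ![pp.1.1, pp.2.1] ![pp.1.2, pp.2.2] := by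
      rw [covariance_comp_eq hΘm hΘμ hmeas, rpSq_eq_integral_centred G r μ b t hb.2.1 hb.2.2.2.2.2 hs₀pos hq₀ y₀]
      have hrefl : ∀ U : LGConfig 4 G,
          (∑' x : Fin 4 → ℤ, b (s₀ • (siteToE x + centreOffset q₀) - y₀) * plane G r q₀ x (cfgReflect U)) =
            ∑' x : Fin 4 → ℤ, b (s₀ • (siteToE x + centreOffset q₀) - mirrorOffset t y₀) * plane G r q₀ x U :=
        fun U => atom_comp_cfgReflect r t hb.2.2.2.2.2 hq₀ s₀ y₀ U
      have hmean : (∫ V, (∑' x : Fin 4 → ℤ, b (s₀ • (siteToE x + centreOffset q₀) - y₀) * plane G r q₀ x V) ∂μ) =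
          ∫ V, (∑' x : Fin 4 → ℤ, b (s₀ • (siteToE x + centreOffset q₀) - mirrorOffset t y₀) * plane G r q₀ x V) ∂μ := by
        rw [← integral_comp_eq hΘm hΘμ hmeas]
        exact integral_congr_ae (Eventually.of_forall hrefl)
      refine integral_congr_ae (Eventually.of_forall fun U => ?_)
      simp only
      rw [hrefl U]
      congr 1
      rw [hmean]
    by_cases hcoarse : s₀ ≤ 1
    · obtain ⟨hy₀, hcol'⟩ := hcol hcoarse
      exact ⟨s₀, hs₀pos, hcoarse, q₀, y₀, hq₀, hy₀, hcol', hεle.trans (hε₁le.trans hS6.le)⟩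
    · -- S7: a UV atom contradicts the plaquette deficit (any offset)
      exfalso
      push Not at hcoarse
      have hbound := abs_rpSq_le_of_deficit r μ t hR₀ hb.2.1 hb.2.2.2.2.2 hMb (q := q₀) (D := r.N * η)
        (fun x => hdef q₀ hq₀ x) one_pos hcoarse.le y₀
      have hlt := (le_abs_self _).trans hbound
      exact absurd ((hε₁le.trans hS6.le).trans hlt) (not_le.2 hUV)
  -- S5 ⇒ S6–S8 in whichever family the active atom sits
  rcases hpig with ⟨i, -, hni⟩ | ⟨j, -, hnj⟩
  · have hsq : √(cov[fun U => F i (cfgReflect U), F i; μ]) ^ 2 = cov[fun U => F i (cfgReflect U), F i; μ] :=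
      Real.sq_sqrt (hnn i)
    rw [hsq] at hni
    exact key (q i) (sI i) (y i) (hfam i).1 (hfam i).2.1 (hfam i).2.2.2 hni
  · have hsq : √(cov[fun U => F' j (cfgReflect U), F' j; μ]) ^ 2 = cov[fun U => F' j (cfgReflect U), F' j; μ] :=
      Real.sq_sqrt (hnn' j)
    rw [hsq] at hnj
    exact key (q' j) (sI' j) (y' j) (hfam' j).1 (hfam' j).2.1 (hfam' j).2.2.2 hnj

/-- **The shared stub from an atomic cross floor**: `CrossFloorAtomsP → StubCoarseCollarP` (one-line corollary of
`coarseAtomFloor_of_crossFloorDatum`; the stub's hypothesis `StubUVQuietP` is not used). -/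
theorem coarseCollar_of_crossFloor (hCF : CrossFloorAtomsP) : StubCoarseCollarP := by
  intro hSynth _hUV hQ2 G _ _ _ _ hG hSU
  letI : MeasurableSpace G := borel G
  haveI : BorelSpace G := ⟨rfl⟩
  exact coarseAtomFloor_of_crossFloorDatum (hCF hSynth hQ2 G hG hSU)

end Summit.QuantumFields.YangMills.Theorems.RPOnsetFloorCoarseCollar

end
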